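import Summits.AtomisticToContinuum.Crystallization.Theorems.HullExactificationCascadeZeroDefectDensityOctahedron
import HarnessLib

/-!
# The soft unit octahedron lemma, squared form with the sharper constants (`oct_sq_bounds`)
# (route `HullExactificationCascade`, crux `ZeroDefectDensity`, stmt-AtomisticToContinuum-12086)

`HullExactificationCascadeZeroDefectDensityOctahedron.lean` lands the registered stub
`stub_octahedron` (`|diagonal - √2| ≤ 30η`) and, on the way, proves sharper SQUARED bounds that the
trilateration in `stub_assembly` wants directly: for six points `u w z₁ z₂ z₃ z₄ : ℝ³` spanning the
octahedral graph with the twelve edges in `[1-η, 1+η]` (`0 ≤ η ≤ 1/1000`) and the three diagonals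
`≥ 1.31`,

* `|dist z₁ z₃ ² - 2| ≤ 38η`, `|dist z₂ z₄ ² - 2| ≤ 38η` (equator diagonals, `oct_solve_D`),
* `|dist u w ² - 2| ≤ 29η` (the axis, `oct_solve_H`).

This file only re-assembles those constants from the landed real-arithmetic lemmas
(`oct_apex`, `oct_edge`, `oct_frame3`, `oct_solve_frame`, `oct_solve_H`, `oct_solve_D`):
`oct_core13v_sq` / `oct_core13_sq` are the squared-form twins of `oct_core13v` / `oct_core13`, and
`oct_sq_bounds` (verbatim the registered sub-goal signature) applies them twice (cyclic relabelling
`z₁z₂z₃z₄ ↦ z₂z₃z₄z₁`).  It is a `--supports` file for the assembly, not part of the composition.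
-/

noncomputable section

namespace Summit.AtomisticToContinuum.Crystallization.Theorems.ZeroDefectDensityBirth

open RealInnerProductSpace

/-- **Soft unit octahedron, vector form, squared constants.** With `v` the half-axis and
`aᵢ = zᵢ - c` the equator relative to the centre `c = (u+w)/2`: twelve soft edges and the three
gaps force `|‖a₁ - a₃‖² - 2| ≤ 38η` and `|(2‖v‖)² - 2| ≤ 29η`. Same proof as `oct_core13v`,
stopping before the square roots. [folklore] -/
theorem oct_core13v_sq (e : ℝ) (a₁ a₂ a₃ a₄ v : EuclideanSpace ℝ (Fin 3)) (he0 : 0 ≤ e)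
    (he : e ≤ 1 / 1000)
    (hu₁ : 1 - e ≤ ‖a₁ + v‖) (hu₁' : ‖a₁ + v‖ ≤ 1 + e)
    (hu₂ : 1 - e ≤ ‖a₂ + v‖) (hu₂' : ‖a₂ + v‖ ≤ 1 + e)
    (hu₃ : 1 - e ≤ ‖a₃ + v‖) (hu₃' : ‖a₃ + v‖ ≤ 1 + e)
    (hu₄ : 1 - e ≤ ‖a₄ + v‖) (hu₄' : ‖a₄ + v‖ ≤ 1 + e)
    (hw₁ : 1 - e ≤ ‖a₁ - v‖) (hw₁' : ‖a₁ - v‖ ≤ 1 + e)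
    (hw₂ : 1 - e ≤ ‖a₂ - v‖) (hw₂' : ‖a₂ - v‖ ≤ 1 + e)
    (hw₃ : 1 - e ≤ ‖a₃ - v‖) (hw₃' : ‖a₃ - v‖ ≤ 1 + e)
    (hw₄ : 1 - e ≤ ‖a₄ - v‖) (hw₄' : ‖a₄ - v‖ ≤ 1 + e)
    (h₁₂ : 1 - e ≤ ‖a₁ - a₂‖) (h₁₂' : ‖a₁ - a₂‖ ≤ 1 + e)
    (h₂₃ : 1 - e ≤ ‖a₂ - a₃‖) (h₂₃' : ‖a₂ - a₃‖ ≤ 1 + e)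
    (h₃₄ : 1 - e ≤ ‖a₃ - a₄‖) (h₃₄' : ‖a₃ - a₄‖ ≤ 1 + e)
    (h₄₁ : 1 - e ≤ ‖a₄ - a₁‖) (h₄₁' : ‖a₄ - a₁‖ ≤ 1 + e)
    (hd : 131 / 100 ≤ ‖a₁ - a₃‖) (hd' : 131 / 100 ≤ ‖a₂ - a₄‖) (hL : 131 / 100 ≤ 2 * ‖v‖) :
    |‖a₁ - a₃‖ ^ 2 - 2| ≤ 38 * e ∧ |(2 * ‖v‖) ^ 2 - 2| ≤ 29 * e := by
  have he1 : e ≤ 1 := by linarith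
  have he2 : e * e ≤ 1 / 1000 * e := mul_le_mul_of_nonneg_right he he0
  -- scalar consequences of the twelve soft edges
  obtain ⟨q₁, p₁, p₁'⟩ := oct_apex he1 hu₁ hu₁' hw₁ hw₁'
  obtain ⟨q₂, p₂, p₂'⟩ := oct_apex he1 hu₂ hu₂' hw₂ hw₂'
  obtain ⟨q₃, p₃, p₃'⟩ := oct_apex he1 hu₃ hu₃' hw₃ hw₃'
  obtain ⟨q₄, p₄, p₄'⟩ := oct_apex he1 hu₄ hu₄' hw₄ hw₄'
  obtain ⟨g₁₂, g₁₂'⟩ := oct_edge he1 h₁₂ h₁₂'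
  obtain ⟨g₂₃, g₂₃'⟩ := oct_edge he1 h₂₃ h₂₃'
  obtain ⟨g₃₄, g₃₄'⟩ := oct_edge he1 h₃₄ h₃₄'
  obtain ⟨g₄₁, g₄₁'⟩ := oct_edge he1 h₄₁ h₄₁'
  have hn₁ : 0 ≤ ⟪a₁, a₁⟫ := real_inner_self_nonneg
  have hn₂ : 0 ≤ ⟪a₂, a₂⟫ := real_inner_self_nonneg
  have hS20 : 0 ≤ ⟪a₁ + a₃, a₁ + a₃⟫ := real_inner_self_nonneg
  -- the three gaps, squared
  have hH4 : 1.7161 ≤ 4 * ⟪v, v⟫ := by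
    have := pow_le_pow_left₀ (by norm_num) hL 2
    rw [mul_pow, ← real_inner_self_eq_norm_sq] at this; linarith
  have hP : 1.7161 ≤ ⟪a₁ - a₃, a₁ - a₃⟫ := by
    have := pow_le_pow_left₀ (by norm_num) hd 2
    rw [← real_inner_self_eq_norm_sq] at this; linarith
  have hP' : 1.7161 ≤ ⟪a₂ - a₄, a₂ - a₄⟫ := by
    have := pow_le_pow_left₀ (by norm_num) hd' 2
    rw [← real_inner_self_eq_norm_sq] at this; linarith
  have hH0 : 0.429 ≤ ⟪v, v⟫ := by linarith
  have hH1 : ⟪v, v⟫ ≤ 1.003 := by linarith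
  -- Gram entries of `s = a₁ + a₃`, `D = a₁ - a₃`, `D' = a₂ - a₄`
  have xSS : ⟪a₁ + a₃, a₁ + a₃⟫ = ⟪a₁, a₁⟫ + ⟪a₃, a₃⟫ + 2 * ⟪a₁, a₃⟫ := by
    simp only [inner_add_left, inner_add_right]; rw [real_inner_comm a₁ a₃]; ring
  have xP : ⟪a₁ - a₃, a₁ - a₃⟫ = ⟪a₁, a₁⟫ + ⟪a₃, a₃⟫ - 2 * ⟪a₁, a₃⟫ := by
    simp only [inner_sub_left, inner_sub_right]; rw [real_inner_comm a₁ a₃]; ring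
  have hP2 : ⟪a₁ - a₃, a₁ - a₃⟫ ≤ 2.3 := by linarith
  have bsD : |⟪a₁ + a₃, a₁ - a₃⟫| ≤ 4 * e := by
    have : ⟪a₁ + a₃, a₁ - a₃⟫ = ⟪a₁, a₁⟫ - ⟪a₃, a₃⟫ := by
      simp only [inner_add_left, inner_sub_right]; rw [real_inner_comm a₁ a₃]; ring
    rw [this, abs_le]; constructor <;> linarith
  have bsv : |⟪a₁ + a₃, v⟫| ≤ 2 * e := by
    rw [inner_add_left]; exact (abs_add_le _ _).trans (by linarith)
  have bvD : |⟪v, a₁ - a₃⟫| ≤ 2 * e := by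
    rw [inner_sub_right, real_inner_comm a₁ v, real_inner_comm a₃ v]
    exact (abs_sub _ _).trans (by linarith)
  have bD'v : |⟪a₂ - a₄, v⟫| ≤ 2 * e := by
    rw [inner_sub_left]; exact (abs_sub _ _).trans (by linarith)
  have bσ : |⟪a₁ + a₃, a₂ - a₄⟫| ≤ 12 * e := by
    have : ⟪a₁ + a₃, a₂ - a₄⟫ = ⟪a₁, a₂⟫ - ⟪a₄, a₁⟫ + ⟪a₂, a₃⟫ - ⟪a₃, a₄⟫ := by
      simp only [inner_add_left, inner_sub_right]
      rw [real_inner_comm a₂ a₃, real_inner_comm a₄ a₁]; ring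
    rw [this, abs_le]; constructor <;> linarith
  have bτ : |⟪a₂ - a₄, a₁ - a₃⟫| ≤ 12 * e := by
    have : ⟪a₂ - a₄, a₁ - a₃⟫ = ⟪a₁, a₂⟫ - ⟪a₂, a₃⟫ - ⟪a₄, a₁⟫ + ⟪a₃, a₄⟫ := by
      simp only [inner_sub_left, inner_sub_right]
      rw [real_inner_comm a₁ a₂, real_inner_comm a₃ a₄]; ring
    rw [this, abs_le]; constructor <;> linarith
  -- three-dimensionality: `s` is short
  obtain ⟨m, hm⟩ := oct_frame3 v (a₁ - a₃)
  have hE1 := hm (a₁ + a₃) (a₁ + a₃)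
  have hE2 := hm (a₂ - a₄) (a₂ - a₄)
  have hE3 := hm (a₁ + a₃) (a₂ - a₄)
  have hS2 : ⟪a₁ + a₃, a₁ + a₃⟫ ≤ 121 * e ^ 2 :=
    oct_solve_frame he0 he hH0 hH1 hP hP2 hP' bsD bsv bvD bD'v bσ bτ hE1 hE2 hE3
  -- the cap height
  have ht : ⟪a₁ + a₃, a₂⟫ = ⟪a₁, a₂⟫ + ⟪a₂, a₃⟫ := by
    rw [inner_add_left, real_inner_comm a₂ a₃]
  have hH : |4 * ⟪v, v⟫ - 2| ≤ 29 * e :=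
    oct_solve_H he0 he hH0 hS20 hS2 hn₂ p₂' ht (real_inner_mul_inner_self_le _ _)
      (by linarith) (by linarith) (by linarith) (by linarith)
  -- the diagonal
  obtain ⟨hD₁, hD₂⟩ := oct_solve_D he0 he hH hS20 hS2 p₁ p₁' p₃ p₃'
    (show ⟪a₁ - a₃, a₁ - a₃⟫ = 2 * ⟪a₁, a₁⟫ + 2 * ⟪a₃, a₃⟫ - ⟪a₁ + a₃, a₁ + a₃⟫ by
      rw [xSS, xP]; ring)
  rw [real_inner_self_eq_norm_sq] at hD₁ hD₂
  refine ⟨abs_le.mpr ⟨by linarith, by linarith⟩, ?_⟩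
  rwa [mul_pow, ← real_inner_self_eq_norm_sq, show (2 : ℝ) ^ 2 * ⟪v, v⟫ = 4 * ⟪v, v⟫ by norm_num]

/-- **Soft unit octahedron, one diagonal and the axis, squared constants.** Six points
`u w z₁ z₂ z₃ z₄` spanning the octahedral graph with its twelve edges in `[1-η, 1+η]`
(`η ≤ 1/1000`) and the three diagonals `≥ 1.31` have `|dist z₁ z₃ ² - 2| ≤ 38η` and
`|dist u w ² - 2| ≤ 29η`. [folklore] -/
theorem oct_core13_sq (η : ℝ) (u w z₁ z₂ z₃ z₄ : EuclideanSpace ℝ (Fin 3)) (hη0 : 0 ≤ η)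
    (hη : η ≤ 1 / 1000)
    (hu₁ : 1 - η ≤ dist u z₁) (hu₁' : dist u z₁ ≤ 1 + η)
    (hu₂ : 1 - η ≤ dist u z₂) (hu₂' : dist u z₂ ≤ 1 + η)
    (hu₃ : 1 - η ≤ dist u z₃) (hu₃' : dist u z₃ ≤ 1 + η)
    (hu₄ : 1 - η ≤ dist u z₄) (hu₄' : dist u z₄ ≤ 1 + η)
    (hw₁ : 1 - η ≤ dist w z₁) (hw₁' : dist w z₁ ≤ 1 + η)
    (hw₂ : 1 - η ≤ dist w z₂) (hw₂' : dist w z₂ ≤ 1 + η)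
    (hw₃ : 1 - η ≤ dist w z₃) (hw₃' : dist w z₃ ≤ 1 + η)
    (hw₄ : 1 - η ≤ dist w z₄) (hw₄' : dist w z₄ ≤ 1 + η)
    (h₁₂ : 1 - η ≤ dist z₁ z₂) (h₁₂' : dist z₁ z₂ ≤ 1 + η)
    (h₂₃ : 1 - η ≤ dist z₂ z₃) (h₂₃' : dist z₂ z₃ ≤ 1 + η)
    (h₃₄ : 1 - η ≤ dist z₃ z₄) (h₃₄' : dist z₃ z₄ ≤ 1 + η)
    (h₄₁ : 1 - η ≤ dist z₄ z₁) (h₄₁' : dist z₄ z₁ ≤ 1 + η)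
    (hd : 131 / 100 ≤ dist z₁ z₃) (hd' : 131 / 100 ≤ dist z₂ z₄) (hL : 131 / 100 ≤ dist u w) :
    |dist z₁ z₃ ^ 2 - 2| ≤ 38 * η ∧ |dist u w ^ 2 - 2| ≤ 29 * η := by
  -- half-axis `v`, so that `w = u + 2v`
  obtain ⟨v, hv⟩ : ∃ v : EuclideanSpace ℝ (Fin 3), w - u = v + v :=
    ⟨(1 / 2 : ℝ) • (w - u), by rw [← add_smul]; norm_num⟩
  obtain rfl : w = v + v + u := sub_eq_iff_eq_add.mp hv
  have Eu : ∀ z, dist u z = ‖(z - u - v) + v‖ := fun z => by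
    rw [dist_comm, dist_eq_norm]; congr 1; abel
  have Ew : ∀ z, dist (v + v + u) z = ‖(z - u - v) - v‖ := fun z => by
    rw [dist_comm, dist_eq_norm]; congr 1; abel
  have Ez : ∀ z z', dist z z' = ‖(z - u - v) - (z' - u - v)‖ := fun z z' => by
    rw [dist_eq_norm]; congr 1; abel
  have Euw : dist u (v + v + u) = 2 * ‖v‖ := by
    rw [dist_comm, dist_eq_norm, add_sub_cancel_right, ← two_smul ℝ v, norm_smul,
      Real.norm_eq_abs, abs_of_pos two_pos]
  rw [Eu z₁] at hu₁ hu₁'; rw [Eu z₂] at hu₂ hu₂'; rw [Eu z₃] at hu₃ hu₃'; rw [Eu z₄] at hu₄ hu₄'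
  rw [Ew z₁] at hw₁ hw₁'; rw [Ew z₂] at hw₂ hw₂'; rw [Ew z₃] at hw₃ hw₃'; rw [Ew z₄] at hw₄ hw₄'
  rw [Ez z₁ z₂] at h₁₂ h₁₂'; rw [Ez z₂ z₃] at h₂₃ h₂₃'; rw [Ez z₃ z₄] at h₃₄ h₃₄'
  rw [Ez z₄ z₁] at h₄₁ h₄₁'; rw [Ez z₁ z₃] at hd ⊢; rw [Ez z₂ z₄] at hd'; rw [Euw] at hL ⊢
  exact oct_core13v_sq η (z₁ - u - v) (z₂ - u - v) (z₃ - u - v) (z₄ - u - v) v hη0 hη hu₁ hu₁'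
    hu₂ hu₂' hu₃ hu₃' hu₄ hu₄' hw₁ hw₁' hw₂ hw₂' hw₃ hw₃' hw₄ hw₄' h₁₂ h₁₂' h₂₃ h₂₃' h₃₄ h₃₄'
    h₄₁ h₄₁' hd hd' hL

/-- **Soft unit octahedron lemma, squared form** (registered sub-goal `oct_sq_bounds` of
stmt-AtomisticToContinuum-12086, for `stub_assembly` of the line `birth`). Six points
`u w z₁ z₂ z₃ z₄ : ℝ³` spanning the octahedral graph (`u`, `w` joined to each `zᵢ`, and the
4-cycle `z₁z₂z₃z₄`) with the twelve edges in `[1-η, 1+η]`, `0 ≤ η ≤ 1/1000`, and the three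
diagonals `z₁z₃, z₂z₄, uw ≥ 1.31` have `|dist z₁ z₃ ² - 2| ≤ 38η`, `|dist z₂ z₄ ² - 2| ≤ 38η` and
`|dist u w ² - 2| ≤ 29η` — the constants proved on the way to `stub_octahedron` (p152353), exposed.
[folklore] -/
theorem oct_sq_bounds : ∀ (η : ℝ) (u w z₁ z₂ z₃ z₄ : EuclideanSpace ℝ (Fin 3)), 0 ≤ η → η ≤ 1 / 1000 → 1 - η ≤ dist u z₁ → dist u z₁ ≤ 1 + η → 1 - η ≤ dist u z₂ → dist u z₂ ≤ 1 + η → 1 - η ≤ dist u z₃ → dist u z₃ ≤ 1 + η → 1 - η ≤ dist u z₄ → dist u z₄ ≤ 1 + η → 1 - η ≤ dist w z₁ → dist w z₁ ≤ 1 + η → 1 - η ≤ dist w z₂ → dist w z₂ ≤ 1 + η → 1 - η ≤ dist w z₃ → dist w z₃ ≤ 1 + η → 1 - η ≤ dist w z₄ → dist w z₄ ≤ 1 + η → 1 - η ≤ dist z₁ z₂ → dist z₁ z₂ ≤ 1 + η → 1 - η ≤ dist z₂ z₃ → dist z₂ z₃ ≤ 1 + η → 1 - η ≤ dist z₃ z₄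 → dist z₃ z₄ ≤ 1 + η → 1 - η ≤ dist z₄ z₁ → dist z₄ z₁ ≤ 1 + η → 131 / 100 ≤ dist z₁ z₃ → 131 / 100 ≤ dist z₂ z₄ → 131 / 100 ≤ dist u w → |dist z₁ z₃ ^ 2 - 2| ≤ 38 * η ∧ |dist z₂ z₄ ^ 2 - 2| ≤ 38 * η ∧ |dist u w ^ 2 - 2| ≤ 29 * η := by
  intro η u w z₁ z₂ z₃ z₄ hη0 hη hu₁ hu₁' hu₂ hu₂' hu₃ hu₃' hu₄ hu₄' hw₁ hw₁' hw₂ hw₂' hw₃ hw₃'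
    hw₄ hw₄' h₁₂ h₁₂' h₂₃ h₂₃' h₃₄ h₃₄' h₄₁ h₄₁' hd hd' hL
  have A := oct_core13_sq η u w z₁ z₂ z₃ z₄ hη0 hη hu₁ hu₁' hu₂ hu₂' hu₃ hu₃' hu₄ hu₄' hw₁ hw₁'
    hw₂ hw₂' hw₃ hw₃' hw₄ hw₄' h₁₂ h₁₂' h₂₃ h₂₃' h₃₄ h₃₄' h₄₁ h₄₁' hd hd' hL
  have B := oct_core13_sq η u w z₂ z₃ z₄ z₁ hη0 hη hu₂ hu₂' hu₃ hu₃' hu₄ hu₄' hu₁ hu₁' hw₂ hw₂'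
    hw₃ hw₃' hw₄ hw₄' hw₁ hw₁' h₂₃ h₂₃' h₃₄ h₃₄' h₄₁ h₄₁' h₁₂ h₁₂' hd' (by rwa [dist_comm]) hL
  exact ⟨A.1, B.1, A.2⟩

end Summit.AtomisticToContinuum.Crystallization.Theorems.ZeroDefectDensityBirth
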